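import Summits.HodgeConjecture.HodgeConjecture.Theorems.NikulinTwinTransportTwinSimilitudeAlgebraicMarkings

/-!
# Route NikulinTwinTransport · frame item `Assembly` (stmt-HodgeConjecture-13942) —
# the eigenvalue of real multiplication on the `(2,0)`-line: the `λ`-dichotomy

Helper toward the frame item (and toward removing the coniveau fact
`Grothendieck1969_supportedClasses_le_hodgeConiveau`, "`N¹H² ⊆ H^{1,1}`", from the glue). Let `S`
be a marked projective K3 surface (`η`, `σ = η⁻¹x₀` the `(2,0)`-class, `σ̄ = η⁻¹x̄₀`, the Hodge
types of `H²` read off `σ, σ̄`) and `e` a cup-self-adjoint, type-preserving endomorphism of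
`H²(S(ℂ); ℂ)` killing the divisor classes `NS = N¹H²`. Then `eσ = λσ` and `eσ̄ = λσ̄` with ONE
scalar `λ` (`apply_conj_eq_smul_of_apply_eq_smul`), and:

* `λ ≠ 0` (`isOfHodgeType_oneOne_of_mem_algebraicClasses_of_ne_zero`): every divisor class is of
  type `(1,1)` — `λ (d.σ) = (d.eσ) = (ed.σ) = 0` — WITHOUT the coniveau fact;
* `λ = 0` (`forall_orthogonal_eq_zero_of_apply_lines_eq_zero`): if moreover `e` is rational,
  `e² = 2` on `NS^⊥` and Lefschetz `(1,1)` holds on `S`, then `NS^⊥ = 0` — every `ex` is of type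
  `(1,1)`, so `e(ex) = 0` for rational `x` (hence for all `x`), and `2x = e(ex) = 0` on `NS^⊥`.
  (Then all of `H²` is algebraic, `algebraicClasses_one_eq_top_of_forall_orthogonal_eq_zero`, and
  the Hodge conjecture for `S ⊗ S` holds outright, `…AssemblySquareAllAlgebraic`.)

The computations are those of the degenerate case of
`realMultiplicationSqrtTwo_algebraic_of_selfTwoSimilitudes` (seat 13681), isolated as lemmas.
No new definitions, no named facts. Prover seat prover-pitem-stmt-HodgeConjecture-13942-0.
-/

noncomputable section

namespace Summit.HodgeConjecture.HodgeConjecture.Theorems.NikulinTwinTransport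

open CategoryTheory MonoidalCategory
open Literature.AlgebraicGeometry.Motives Literature.AlgebraicGeometry.HodgeTheory
open Literature.AlgebraicGeometry.Surfaces
open Literature.AlgebraicTopology.SingularHomology

variable {S : SchemeOver ℂ}

/-- **One eigenvalue on both lines.** If `eσ = lσ`, `eσ̄ = l'σ̄` for a cup-self-adjoint `e` and
`(σ.σ̄) ≠ 0` (read through the marking: `(x₀.x̄₀) ≠ 0`, `p ≠ 0`), then `l = l'`.
[cite: Zarhin1983, §2 (self-adjointness of real multiplication)] -/
theorem apply_conj_eq_smul_of_apply_eq_smul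
    (η : complexBetti S (2 * 1) ≃ₗ[ℂ] (K3Index → ℂ)) {p : complexBetti S (2 * 2)} (hp : p ≠ 0)
    (hηcup : ∀ a b : complexBetti S (2 * 1),
      cupProduct (rfl : 2 * 1 + 2 * 1 = 2 * 2) a b = k3Form (η a) (η b) • p)
    (x₀ : K3Index → ℂ) (hk : k3Form x₀ (star x₀) ≠ 0)
    (e : complexBetti S (2 * 1) →ₗ[ℂ] complexBetti S (2 * 1))
    (he_adj : ∀ x y : complexBetti S (2 * 1),
      cupProduct (rfl : 2 * 1 + 2 * 1 = 2 * 2) (e x) y = cupProduct (rfl : 2 * 1 + 2 * 1 = 2 * 2) x (e y))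
    {l l' : ℂ} (hl : e (η.symm x₀) = l • η.symm x₀) (hl' : e (η.symm (star x₀)) = l' • η.symm (star x₀)) :
    l = l' := by
  have hσσ' : cupProduct (rfl : 2 * 1 + 2 * 1 = 2 * 2) (η.symm x₀) (η.symm (star x₀)) =
      k3Form x₀ (star x₀) • p := by
    rw [hηcup, LinearEquiv.apply_symm_apply, LinearEquiv.apply_symm_apply]
  have h := he_adj (η.symm x₀) (η.symm (star x₀))
  rw [hl, hl', LinearMap.map_smul₂, LinearMap.map_smul, hσσ', smul_smul, smul_smul] at h
  exact mul_right_cancel₀ hk (smul_left_injective ℂ hp h)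

/-- **`λ ≠ 0`: the divisor classes are of type `(1,1)` without the coniveau fact.** For `e`
cup-self-adjoint, killing `NS = N¹H²`, with `eσ = lσ`, `eσ̄ = lσ̄`, `l ≠ 0`: every `d ∈ NS` has
`l (d.σ) = (d.eσ) = (ed.σ) = 0`, likewise with `σ̄`, hence is of type `(1,1)` by the description
`H^{1,1} = ⟨σ, σ̄⟩^⊥` of the Hodge types of `H²(K3)`. [cite: Huybrechts2016K3, Ch. 6 Prop. 1.2 and Ch. 3 §3.2] -/
theorem isOfHodgeType_oneOne_of_mem_algebraicClasses_of_ne_zero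
    (η : complexBetti S (2 * 1) ≃ₗ[ℂ] (K3Index → ℂ)) (x₀ : K3Index → ℂ)
    (h3 : ∀ c : complexBetti S (2 * 1), IsOfHodgeType 2 S (2 * 1) 1 1 c ↔
      cupProduct (rfl : 2 * 1 + 2 * 1 = 2 * 2) c (η.symm x₀) = 0 ∧
        cupProduct (rfl : 2 * 1 + 2 * 1 = 2 * 2) c (η.symm (star x₀)) = 0)
    (e : complexBetti S (2 * 1) →ₗ[ℂ] complexBetti S (2 * 1))
    (he_adj : ∀ x y : complexBetti S (2 * 1),
      cupProduct (rfl : 2 * 1 + 2 * 1 = 2 * 2) (e x) y = cupProduct (rfl : 2 * 1 + 2 * 1 = 2 * 2) x (e y))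
    (he_N : ∀ d ∈ algebraicClasses S 1, e d = 0)
    {l : ℂ} (hl : e (η.symm x₀) = l • η.symm x₀) (hl' : e (η.symm (star x₀)) = l • η.symm (star x₀))
    (hl0 : l ≠ 0) {d : complexBetti S (2 * 1)} (hd : d ∈ algebraicClasses S 1) :
    IsOfHodgeType 2 S (2 * 1) 1 1 d := by
  refine (h3 d).2 ⟨?_, ?_⟩
  · have h := he_adj d (η.symm x₀)
    rw [he_N d hd, map_zero, LinearMap.zero_apply, hl, LinearMap.map_smul] at h
    exact (smul_eq_zero.1 h.symm).resolve_left hl0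
  · have h := he_adj d (η.symm (star x₀))
    rw [he_N d hd, map_zero, LinearMap.zero_apply, hl', LinearMap.map_smul] at h
    exact (smul_eq_zero.1 h.symm).resolve_left hl0

/-- **`λ = 0`: nothing is transcendental.** For a marked projective K3 surface (`η` identifying the
integral classes with `Λ`, `H^{1,1} = ⟨σ, σ̄⟩^⊥` with `σ = η⁻¹x₀`, `σ̄ = η⁻¹x̄₀`), Lefschetz `(1,1)`
on `S`, and `e` rational, cup-self-adjoint, killing `NS = N¹H²`, with `e(ex) = 2x` on `NS^⊥` and
`eσ = eσ̄ = 0`: then `NS^⊥ = 0`. Indeed every `ex` is orthogonal to `σ, σ̄` (`(ex.σ) = (x.eσ) = 0`),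
i.e. of type `(1,1)`; for rational `x` it is rational, hence a divisor class (Lefschetz), hence
killed by `e`; the integral classes `η⁻¹eⱼ` span, so `e ∘ e = 0`, and on `NS^⊥` this reads
`2x = 0`. [cite: Varesco2023, Thm. 2.1 and Rem. 2.2] [cite: Huybrechts2016K3, Ch. 6 Prop. 1.2] -/
theorem forall_orthogonal_eq_zero_of_apply_lines_eq_zero
    (η : complexBetti S (2 * 1) ≃ₗ[ℂ] (K3Index → ℂ)) (x₀ : K3Index → ℂ)
    (hηint : ∀ c : complexBetti S (2 * 1), IsIntegralClass c ↔ ∃ v : K3Index → ℤ, η c = fun i => (v i : ℂ))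
    (h3 : ∀ c : complexBetti S (2 * 1), IsOfHodgeType 2 S (2 * 1) 1 1 c ↔
      cupProduct (rfl : 2 * 1 + 2 * 1 = 2 * 2) c (η.symm x₀) = 0 ∧
        cupProduct (rfl : 2 * 1 + 2 * 1 = 2 * 2) c (η.symm (star x₀)) = 0)
    (hL : ∀ c : complexBetti S (2 * 1), IsRationalClass c → IsOfHodgeType 2 S (2 * 1) 1 1 c →
      c ∈ algebraicClasses S 1)
    (e : complexBetti S (2 * 1) →ₗ[ℂ] complexBetti S (2 * 1))
    (he_rat : ∀ x, IsRationalClass x → IsRationalClass (e x))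
    (he_adj : ∀ x y : complexBetti S (2 * 1),
      cupProduct (rfl : 2 * 1 + 2 * 1 = 2 * 2) (e x) y = cupProduct (rfl : 2 * 1 + 2 * 1 = 2 * 2) x (e y))
    (he_N : ∀ d ∈ algebraicClasses S 1, e d = 0)
    (he_T : ∀ x : complexBetti S (2 * 1),
      (∀ d ∈ algebraicClasses S 1, cupProduct (rfl : 2 * 1 + 2 * 1 = 2 * 2) x d = 0) →
        e (e x) = (2 : ℂ) • x)
    (heσ : e (η.symm x₀) = 0) (heσ' : e (η.symm (star x₀)) = 0)
    (x : complexBetti S (2 * 1))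
    (hx : ∀ d ∈ algebraicClasses S 1, cupProduct (rfl : 2 * 1 + 2 * 1 = 2 * 2) x d = 0) :
    x = 0 := by
  -- every `e y` is of type `(1,1)`
  have h11 : ∀ y, IsOfHodgeType 2 S (2 * 1) 1 1 (e y) := fun y =>
    (h3 _).2 ⟨by rw [he_adj, heσ, map_zero], by rw [he_adj, heσ', map_zero]⟩
  -- so `e (e y) = 0` for rational `y` (Lefschetz (1,1): `e y ∈ NS`), hence for all `y`
  have hee_rat : ∀ y, IsRationalClass y → e (e y) = 0 := fun y hy =>
    he_N _ (hL (e y) (he_rat y hy) (h11 y))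
  have hee : ∀ y, e (e y) = 0 := by
    intro y
    have hy : y = ∑ j, (η y) j • η.symm (fun i => ((Pi.single j (1 : ℤ) : K3Index → ℤ) i : ℂ)) := by
      apply η.injective
      rw [map_sum]
      simp_rw [map_smul, LinearEquiv.apply_symm_apply]
      exact pi_eq_sum_single (η y)
    rw [hy, map_sum, map_sum]
    refine Finset.sum_eq_zero fun j _ => ?_
    rw [map_smul, map_smul,
      hee_rat _ ((hηint _).2 ⟨Pi.single j 1, η.apply_symm_apply _⟩).isRationalClass, smul_zero]
  -- `2 x = e (e x) = 0`
  have h := he_T x hx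
  rw [hee] at h
  exact (smul_eq_zero.1 h.symm).resolve_left two_ne_zero

end Summit.HodgeConjecture.HodgeConjecture.Theorems.NikulinTwinTransport

end
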